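import Summits.Ventures.PercRepro.ProfilePointedMirrorBridges
import Summits.Ventures.PercRepro.ProfileBiIndepShiftSup
import Summits.Ventures.PercRepro.ProfilePointedMirrorUpsetMid
import Summits.Ventures.PercRepro.ProfilePointedMirrorUpsetGirth
import Summits.Ventures.PercRepro.ProfilePointedMirrorUpsetBottom
import Summits.Ventures.PercRepro.ProfilePointedMirrorLimit

/-!
# PercRepro — (NC): THE NORMALISED MATCHING PROPERTY OF THE CLOSURE-POOLED BI-INDEPENDENT COMPLEX BETWEEN CONSECUTIVE
LEVELS — THE MASTER STATEMENT ABOVE (H-gen), (PM-flat), (H), (C1″) AND (mod Theorem A) (D-gen), (D) (p10, gen 29)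

For a finite matroid `M` on `n` elements write `BI_j` for its bi-independent `j`-sets (`biIndepSets M j`), `P_j = #BI_j`, and
for an up-set `U` of flats `u_j(U) = #{X ∈ BI_j : cl X ∈ U}` (`upCount M U j`, ProfilePointedMirrorUpset).

**CONJECTURE (NC)** (`NormCons`, NOT asserted): for EVERY up-set `U` of flats of EVERY finite matroid and EVERY level `j`,
`u_j(U) · P_{j+1} ≤ u_{j+1}(U) · P_j` — the density `u_j(U) / P_j` of any closure-defined increasing property among the
bi-independent sets is NON-DECREASING in the level.  (Equivalently, by max-flow / min-cut: for every family `𝒜` of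
rank-`j` flats, `β(𝒜) · P_{j+1} ≤ β(N(𝒜)) · P_j`, where `β(F) = #{X ∈ BI : cl X = F}` and `N(𝒜)` is the set of rank-`(j+1)`
flats containing a member of `𝒜` — the normalised matching property of the lattice of flats weighted by `β` between
consecutive ranks.)  DATA (own exact code, mining/p10/g29/): 0 failures on EVERY matroid with `≤ 8` elements at EVERY pair of
levels `j < j′` (the flow form; 1,724 classes at `n = 8`), on every sub-cube fibre `{Z : Z ∩ A = ∅, B ⊆ Z}` at `n ≤ 6`, and on
every PAIR `(M₁, M₂)` of matroids on one ground set (`X ∈ I(M₁)`, `E ∖ X ∈ I(M₂)`, pools by `M₁`-closures) at `n ≤ 6`; the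
`n = 9` catalogue by kit.  The UNPOOLED (set-level) statement is FALSE (`Θ₃` + chord at `n = 7`).

THIS FILE: the definition, the telescoping, and the bridges:
* **`upsetMirror_of_normCons` : (NC) ⟹ (H-gen)** for every up-set (`UpsetMirror`, hence `SepMirror`): the densities
  `u_j / P_j` are non-decreasing on `[k, n − k]` (`upCount_mul_le_of_normCons_steps`, no internal zeros of `P` there by
  `exists_mem_biIndepSets_superset`) and `P_k = P_{n−k}`;
* hence (NC) ⟹ (PM-flat) (`biIndepFlatSup_of_normCons`), ⟹ (H) (`capMirror_of_normCons`), ⟹ the per-point form of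
  Theorem A (`biIndepPointed_of_normCons`), ⟹ (C1″) (`capLimitPlus_of_normCons`);
* **`avoidRowUpset_of_normCons_of_fact` : (NC) + the named fact (Theorem A's normalised step) ⟹ (D-gen)**, hence (D)
  (`avoidRow_of_normCons_of_fact`): `F_k = P_k − u_{n−k}` (`avoidUpCount_add_card_filter_clF_mem_mirror`), so `F_k / P_k` is
  non-decreasing and `(n − k) P_k ≤ (k + 1) P_{k+1}` finishes;
* UNCONDITIONAL REGIMES of the step: every level `j + 1 ≥ rk E` (`normConsStep_of_rk_le`), every level `j < n − rk E`
  (`normConsStep_of_lt`), and the GIRTH REGIME `girth ≥ n − j + 2`, `2j + 1 ≤ n`, where the step is the local LYM inequality of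
  the Boolean lattice (`normConsStep_of_indep`).
Nothing here asserts (NC), (H-gen), (H), (D) or Theorem A.
-/

open scoped Matroid

namespace PercRepro.Cogirth

open Finset ThmH Skew

variable {α : Type} [DecidableEq α] {M : Matroid α} [M.Finite]

/-! ### The statement -/

/-- The consecutive normalised step of the up-set `U` at level `j`: `u_j(U) · P_{j+1} ≤ u_{j+1}(U) · P_j`. -/
def NormConsStep (M : Matroid α) [M.Finite] (U : Finset (Finset α)) (j : ℕ) : Prop :=
  upCount M U j * (biIndepSets M (j + 1)).card ≤ upCount M U (j + 1) * (biIndepSets M j).card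

/-- **CONJECTURE (NC) (NOT asserted)**: for every finite matroid on `α`, every up-set `U` of its flats and every level `j`,
`u_j(U) · P_{j+1} ≤ u_{j+1}(U) · P_j`. -/
def NormCons (α : Type) [DecidableEq α] : Prop :=
  ∀ (M : Matroid α) [M.Finite] (U : Finset (Finset α)), UpFlats M U → ∀ j : ℕ, NormConsStep M U j

/-- `u_j(U) ≤ P_j`. -/
theorem upCount_le_card (U : Finset (Finset α)) (j : ℕ) : upCount M U j ≤ (biIndepSets M j).card :=
  card_filter_le _ _

/-- `u_j(U) = 0` when `BI_j = ∅`. -/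
theorem upCount_eq_zero_of_card_eq_zero {U : Finset (Finset α)} {j : ℕ} (h : (biIndepSets M j).card = 0) :
    upCount M U j = 0 :=
  Nat.eq_zero_of_le_zero (h ▸ upCount_le_card U j)

/-! ### Telescoping -/

/-- Consecutive normalised steps `u_j · P_{j+1} ≤ u_{j+1} · P_j` on `[k, k + d)` with `P > 0` strictly inside telescope to
`u_k · P_{k+d} ≤ u_{k+d} · P_k`. -/
theorem mul_le_mul_of_steps (u P : ℕ → ℕ) {k : ℕ} (d : ℕ)
    (hstep : ∀ j, k ≤ j → j < k + d → u j * P (j + 1) ≤ u (j + 1) * P j)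
    (hpos : ∀ j, k < j → j < k + d → 0 < P j) :
    u k * P (k + d) ≤ u (k + d) * P k := by
  induction d with
  | zero => simp
  | succ d ih =>
    have ih' := ih (fun j hj hj' => hstep j hj (by omega)) (fun j hj hj' => hpos j hj (by omega))
    have hs := hstep (k + d) (by omega) (by omega)
    rcases Nat.eq_zero_or_pos d with hd | hd
    · subst hd
      simpa using hs
    · have hp := hpos (k + d) (by omega) (by omega)
      have h1 : u k * P (k + d + 1) * P (k + d) ≤ u (k + d + 1) * P k * P (k + d) := by
        calc u k * P (k + d + 1) * P (k + d) = (u k * P (k + d)) * P (k + d + 1) := by ring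
          _ ≤ (u (k + d) * P k) * P (k + d + 1) := Nat.mul_le_mul_right _ ih'
          _ = (u (k + d) * P (k + d + 1)) * P k := by ring
          _ ≤ (u (k + d + 1) * P (k + d)) * P k := Nat.mul_le_mul_right _ hs
          _ = u (k + d + 1) * P k * P (k + d) := by ring
      rw [show k + (d + 1) = k + d + 1 by omega]
      exact Nat.le_of_mul_le_mul_right h1 hp

/-- No internal zeros: a non-empty level `k` forces every level `j` with `k ≤ j ≤ n − k` non-empty. -/
theorem card_biIndepSets_pos_of_pos {k j : ℕ} (hkj : k ≤ j) (hj : j + k ≤ (gr M).card)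
    (hk : 0 < (biIndepSets M k).card) : 0 < (biIndepSets M j).card := by
  obtain ⟨X, hX⟩ := card_pos.1 hk
  obtain ⟨X', hX', -⟩ := exists_mem_biIndepSets_superset hkj hj hX
  exact card_pos.2 ⟨X', hX'⟩

/-- The steps of `U` at every level give `u_k(U) · P_{k′} ≤ u_{k′}(U) · P_k` for `k ≤ k′ ≤ n − k`. -/
theorem upCount_mul_le_of_normCons_steps {U : Finset (Finset α)} (hstep : ∀ j, NormConsStep M U j) {k k' : ℕ}
    (hkk' : k ≤ k') (hk' : k' + k ≤ (gr M).card) :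
    upCount M U k * (biIndepSets M k').card ≤ upCount M U k' * (biIndepSets M k).card := by
  rcases Nat.eq_zero_or_pos (biIndepSets M k).card with h0 | hpos
  · rw [upCount_eq_zero_of_card_eq_zero h0]
    simp
  · obtain ⟨d, rfl⟩ := Nat.exists_eq_add_of_le hkk'
    apply mul_le_mul_of_steps (fun j => upCount M U j) (fun j => (biIndepSets M j).card) d
    · intro j _ _
      exact hstep j
    · intro j hj hj'
      exact card_biIndepSets_pos_of_pos (by omega) (by omega) hpos

/-! ### (NC) ⟹ (H-gen) and its consequences -/

/-- **(NC) ⟹ (H-gen) for every up-set**: `u_k ≤ u_{n−k}` for `2k < n`, from the telescoped densities and `P_k = P_{n−k}`. -/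
theorem upsetMirror_of_normCons (h : NormCons α) : UpsetMirror α := by
  intro M _ U hU k hk
  have h1 := upCount_mul_le_of_normCons_steps (M := M) (U := U) (h M U hU) (k := k) (k' := (gr M).card - k)
    (by omega) (by omega)
  rw [← card_biIndepSets_symm M (k := k) (by omega)] at h1
  change upCount M U k ≤ upCount M U ((gr M).card - k)
  rcases Nat.eq_zero_or_pos (biIndepSets M k).card with h0 | hpos
  · rw [upCount_eq_zero_of_card_eq_zero h0]
    exact Nat.zero_le _
  · exact Nat.le_of_mul_le_mul_right h1 hpos

/-- (NC) ⟹ (H-gen) in the separated-set form. -/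
theorem sepMirror_of_normCons (h : NormCons α) : SepMirror α :=
  sepMirror_iff_upsetMirror.2 (upsetMirror_of_normCons h)

/-- (NC) ⟹ (PM-flat): the flat-containment matching `BI_k → BI_{n−k}`. -/
theorem biIndepFlatSup_of_normCons (h : NormCons α) : BiIndepFlatSup α :=
  biIndepFlatSup_iff_forall_upset.2 (upsetMirror_of_normCons h)

/-- (NC) ⟹ (H): the mirror dominance `κ_k ≤ κ_{N−1−k}` of the captured family at every modular cut. -/
theorem capMirror_of_normCons (h : NormCons α) : CapMirror α :=
  capMirror_of_sepMirror (sepMirror_of_normCons h)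

/-- (NC) ⟹ the per-point form `out_k ≤ in_{k+1}` of Theorem A. -/
theorem biIndepPointed_of_normCons (h : NormCons α) : BiIndepPointed α :=
  biIndepPointed_iff_capMirror.2 (capMirror_of_normCons h)

/-- (NC) ⟹ (C1″). -/
theorem capLimitPlus_of_normCons (h : NormCons α) : CapLimitPlus α :=
  capLimitPlus_of_capMirror (capMirror_of_normCons h)

/-! ### (NC) + Theorem A's normalised step ⟹ (D-gen) ⟹ (D) -/

/-- **(NC) + the named fact ⟹ (D-gen)**: with `F_k = P_k − u_{n−k}` the step of (NC) at level `n − k − 1` says that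
`F_k / P_k` is non-decreasing, and Theorem A's normalised step `(n − k) P_k ≤ (k + 1) P_{k+1}` (an equality at the middle of
an odd ground set) turns it into `(n − k) F_k ≤ (k + 1) F_{k+1}`. -/
theorem avoidRowUpset_of_normCons_of_fact (hfact : BiIndepDensityLogConcave α) (h : NormCons α) :
    AvoidRowUpset α := by
  intro M _ U hU k hk
  have e1 := avoidUpCount_add_card_filter_clF_mem_mirror (M := M) U (k := k) (by omega)
  have e2 := avoidUpCount_add_card_filter_clF_mem_mirror (M := M) U (k := k + 1) (by omega)
  have hs := h M U hU ((gr M).card - (k + 1))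
  unfold NormConsStep upCount at hs
  rw [show (gr M).card - (k + 1) + 1 = (gr M).card - k by omega] at hs
  have hsymm1 := card_biIndepSets_symm M (k := k) (by omega)
  have hsymm2 := card_biIndepSets_symm M (k := k + 1) (by omega)
  rw [← hsymm1, ← hsymm2] at hs
  have hA : ((gr M).card - k) * (biIndepSets M k).card ≤ (k + 1) * (biIndepSets M (k + 1)).card := by
    rcases Nat.lt_or_ge (2 * k + 1) (gr M).card with hlt | hge
    · exact biIndepDensity_mono_of_fact hfact M k (by omega)
    · have hP : (biIndepSets M k).card = (biIndepSets M (k + 1)).card := by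
        rw [hsymm1, show (gr M).card - k = k + 1 by omega]
      rw [hP, show (gr M).card - k = k + 1 by omega]
  set Fk := avoidUpCount M U k with hFk
  set Fk1 := avoidUpCount M U (k + 1) with hFk1
  set P0 := (biIndepSets M k).card with hP0
  set P1 := (biIndepSets M (k + 1)).card with hP1
  set u' := ((biIndepSets M ((gr M).card - k)).filter (fun X => clF M X ∈ U)).card with hu'
  set u'' := ((biIndepSets M ((gr M).card - (k + 1))).filter (fun X => clF M X ∈ U)).card with hu''
  have key : Fk * P1 ≤ Fk1 * P0 := by
    have h1 : (Fk + u') * P1 = P0 * P1 := by rw [e1]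
    have h2 : (Fk1 + u'') * P0 = P1 * P0 := by rw [e2]
    rw [add_mul] at h1 h2
    nlinarith [h1, h2, hs, Nat.mul_comm P0 P1]
  rcases Nat.eq_zero_or_pos P1 with h0 | hpos
  · have hP0 : P0 = 0 := by
      by_contra hne
      have := card_biIndepSets_pos_of_pos (M := M) (k := k) (j := k + 1) (by omega) (by omega)
        (Nat.pos_of_ne_zero hne)
      omega
    have hF0 : Fk = 0 := by
      have := card_filter_le (biIndepSets M k) (fun X => clF M (gr M \ X) ∉ U)
      unfold avoidUpCount at hFk
      omega
    rw [hF0]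
    simp
  · have h3 : ((gr M).card - k) * Fk * P1 ≤ (k + 1) * Fk1 * P1 := by
      calc ((gr M).card - k) * Fk * P1 = ((gr M).card - k) * (Fk * P1) := by ring
        _ ≤ ((gr M).card - k) * (Fk1 * P0) := Nat.mul_le_mul_left _ key
        _ = (((gr M).card - k) * P0) * Fk1 := by ring
        _ ≤ ((k + 1) * P1) * Fk1 := Nat.mul_le_mul_right _ hA
        _ = (k + 1) * Fk1 * P1 := by ring
    exact Nat.le_of_mul_le_mul_right h3 hpos

/-- (NC) + the named fact ⟹ conjecture (D) for every pointed matroid. -/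
theorem avoidRow_of_normCons_of_fact (hfact : BiIndepDensityLogConcave α) (h : NormCons α) : AvoidRow α :=
  avoidRow_of_avoidRowUpset (avoidRowUpset_of_normCons_of_fact hfact h)

/-! ### Unconditional regimes of the step -/

/-- Above the rank no set is bi-independent (the mirror of `biIndepSets_eq_empty_of_lt`). -/
theorem biIndepSets_eq_empty_of_rk_lt {k : ℕ} (hk : rk M (gr M) < k) : biIndepSets M k = ∅ := by
  rw [eq_empty_iff_forall_notMem]
  intro X hX
  have hX' := mem_biIndepSets.1 hX
  have h1 := rk_le_rk_gr (M := M) hX'.1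
  omega

/-- **THE STEP AT THE TOP**: at every level `j` with `rk E ≤ j + 1` the step holds (above the rank `P_{j+1} = 0`; at
`j + 1 = rk E` every bi-independent set of level `j + 1` spans `E`, which lies in every non-empty up-set). -/
theorem normConsStep_of_rk_le {U : Finset (Finset α)} (hU : UpFlats M U) {j : ℕ} (hj : rk M (gr M) ≤ j + 1) :
    NormConsStep M U j := by
  unfold NormConsStep
  rcases Nat.lt_or_ge (rk M (gr M)) (j + 1) with hlt | hge
  · rw [biIndepSets_eq_empty_of_rk_lt hlt, card_empty]
    simp
  · have hr : rk M (gr M) = j + 1 := by omega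
    by_cases hE : gr M ∈ U
    · have htop : upCount M U (j + 1) = (biIndepSets M (j + 1)).card := by
        unfold upCount
        have := filter_clF_mem_top (M := M) hU
        rw [hr, if_pos hE] at this
        rw [this]
      rw [htop, Nat.mul_comm]
      exact Nat.mul_le_mul_left _ (upCount_le_card U j)
    · have h0 : upCount M U j = 0 := by
        unfold upCount
        rw [card_eq_zero, filter_eq_empty_iff]
        intro X _ hcl
        exact hE (gr_mem_of_upFlats hU hcl)
      rw [h0]
      simp

/-- **THE STEP AT THE BOTTOM**: at every level `j < n − rk E` the step holds (`BI_j = ∅`). -/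
theorem normConsStep_of_lt (U : Finset (Finset α)) {j : ℕ} (hj : j + rk M (gr M) < (gr M).card) :
    NormConsStep M U j := by
  unfold NormConsStep
  rw [upCount_eq_zero_of_card_eq_zero (by rw [biIndepSets_eq_empty_of_lt hj, card_empty])]
  simp

/-- In the girth regime every `j`-subset of `E` is bi-independent: `BI_j` is the whole level of the Boolean lattice. -/
theorem biIndepSets_eq_powersetCard_of_indep {k j : ℕ} (hk : 2 * k ≤ (gr M).card)
    (hg : ∀ S ⊆ gr M, S.card ≤ (gr M).card - k + 1 → rk M S = S.card) (hkj : k ≤ j)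
    (hjk : j ≤ (gr M).card - k) : biIndepSets M j = (gr M).powersetCard j := by
  ext X
  rw [mem_powersetCard]
  constructor
  · intro hX
    exact ⟨(mem_biIndepSets.1 hX).1, (mem_biIndepSets.1 hX).2.1⟩
  · rintro ⟨hXg, hXj⟩
    exact mem_biIndepSets_of_indep_of_card hk hg hXg hXj hkj hjk

/-- **THE GIRTH REGIME OF (NC)** (unconditional): if every `(n − j + 1)`-subset of `E` is independent and `2j + 1 ≤ n`, the
step at level `j` is the local LYM inequality of the Boolean lattice: `u_j · (n − j) ≤ u_{j+1} · (j + 1)` with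
`C(n, j+1) · (j + 1) = C(n, j) · (n − j)`. -/
theorem normConsStep_of_indep {U : Finset (Finset α)} (hU : UpFlats M U) {j : ℕ} (hj : 2 * j + 1 ≤ (gr M).card)
    (hg : ∀ S ⊆ gr M, S.card ≤ (gr M).card - j + 1 → rk M S = S.card) : NormConsStep M U j := by
  unfold NormConsStep upCount
  rw [filter_clF_mem_eq_upLevel (by omega) hg U le_rfl (by omega),
    filter_clF_mem_eq_upLevel (by omega) hg U (by omega) (by omega),
    biIndepSets_eq_powersetCard_of_indep (by omega) hg le_rfl (by omega),
    biIndepSets_eq_powersetCard_of_indep (by omega) hg (by omega) (by omega),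
    card_powersetCard, card_powersetCard]
  have hlym : (upLevel M U j).card * ((gr M).card - j) ≤ (upLevel M U (j + 1)).card * (j + 1) := by
    apply card_mul_le_card_mul_of_insert_mem (E := gr M) (j := j)
    · intro X hX
      unfold upLevel at hX
      rw [mem_filter, mem_powersetCard] at hX
      exact hX.1
    · intro Y hY
      unfold upLevel at hY
      rw [mem_filter, mem_powersetCard] at hY
      exact hY.1.2
    · intro X hX a ha haX
      unfold upLevel at hX ⊢
      rw [mem_filter, mem_powersetCard] at hX ⊢
      obtain ⟨⟨hXg, hXj⟩, hXU⟩ := hX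
      have hins : insert a X ⊆ gr M := insert_subset ha hXg
      have hcard : (insert a X).card = j + 1 := by rw [card_insert_of_notMem haX, hXj]
      refine ⟨⟨hins, hcard⟩, ?_⟩
      exact hU.up X hXU (insert a X) ⟨hins, clF_eq_self_of_indep_succ hg hins (by omega)⟩ (subset_insert _ _)
  have hc := Nat.choose_succ_right_eq (gr M).card j
  have hpos : 0 < j + 1 := Nat.succ_pos j
  have h1 : (upLevel M U j).card * (gr M).card.choose (j + 1) * (j + 1) ≤
      (upLevel M U (j + 1)).card * (gr M).card.choose j * (j + 1) := by
    calc (upLevel M U j).card * (gr M).card.choose (j + 1) * (j + 1)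
        = (upLevel M U j).card * ((gr M).card.choose (j + 1) * (j + 1)) := by ring
      _ = (upLevel M U j).card * ((gr M).card.choose j * ((gr M).card - j)) := by rw [hc]
      _ = ((upLevel M U j).card * ((gr M).card - j)) * (gr M).card.choose j := by ring
      _ ≤ ((upLevel M U (j + 1)).card * (j + 1)) * (gr M).card.choose j := Nat.mul_le_mul_right _ hlym
      _ = (upLevel M U (j + 1)).card * (gr M).card.choose j * (j + 1) := by ring
  exact Nat.le_of_mul_le_mul_right h1 hpos

end PercRepro.Cogirth
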